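import Mathlib
import Literature.Computability.Complexity.CircuitLightCone
import Literature.Computability.Complexity.CircuitCounting
import Literature.Computability.MetaComplexity.MCSP
import Literature.Computability.MetaComplexity.TruthTablesProofs
import Literature.Computability.MetaComplexity.MCSPStatisticalTest
import Literature.Computability.MetaComplexity.FormulaModelsAE
import Literature.Computability.MetaComplexity.EventuallyUnsolvable
import Literature.Computability.MetaComplexity.OliveiraPichSanthanam2019.GapMCSPMagnification
import HarnessLib

/-!
# The folklore unconditional lower bound for (Gap-)MCSP against general circuits:
# a `B₂`-circuit solving `MCSP[a, b]` at length `N = 2ⁿ` has at least `N - O(b·log(n+b)) - 1` gates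

Folklore, fully proved (no named facts). The hardness-magnification theorems for the Minimum
Circuit Size Problem against GENERAL Boolean circuits — Oliveira–Pich–Santhanam, *Hardness
magnification near state-of-the-art lower bounds*, Theory of Computing 17(11) (2021), Thm. 1.4
(p. 6: *"If there exists ε > 0 such that for every small enough β > 0,
Gap-MCSP[2^{βn}/cn, 2^{βn}] ∉ Circuit[N^{1+ε}], then NP ⊄ Circuit[poly]"*, the tree's
`OliveiraPichSanthanam2019.thm14` / `GapMCSPLowerBound c ε β`), McKay–Murray–Williams STOC 2019
Thm. 1.4 (`MckayMurrayWilliams2019_thm14`: `MCSP[s] ∉ SIZE[N · poly(s)] ⇒ NP ⊄ P/poly`) — ask for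
lower bounds of `N^{1+ε}` resp. `N · poly(s(n))` gates at input length `N = 2ⁿ`. The KNOWN side is
the folklore linear bound: Chen–Jin–Williams, *Sharp threshold results for computational
complexity*, STOC 2020, p. 4: *"it is not hard to establish an Ω(n)-size lower bound for
MCSP[n^{o(1)}]. However, in the case of general circuits, researchers have been stuck for decades on
proving even a 6n-size lower bound for De Morgan circuits"* (locator: held text
`paper:doi-10-1145-3357713-3384283`, p0004 L11). This file PROVES that folklore bound, with the
constant `1`, in the tree's vocabulary, so that the census rows facing these theorems carry a
kernel-checked known side in the SAME model (`B₂` circuits, gates counted, almost-everywhere size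
bound `SIZEae`) as their typed hypotheses:

* **Light cones of fan-in-2 circuits are small in the SIZE** (not only in the depth, cf.
  `Circuit.card_lightCone_le_two_pow`): a circuit with `s` gates of fan-in `≤ K` reads at most
  `(K-1)·s + 1` input variables (`Circuit.card_lightCone_le_size`; `B₂`: `≤ s + 1`,
  `Circuit.card_lightCone_le_size_succ`). Proof: for every set `S` of gates, the union of their
  dependency sets has `≤ (K-1)·#gates + |S|` elements (`GateList.card_biUnion_deps_le`, induction on
  the straight-line program). Hence a circuit is constant on the `≥ 2^{N-|lightCone|}` inputs that
  agree with a fixed input on its light cone (`Circuit.two_pow_le_card_filter_eval_eq`, from the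
  tree's locality lemma `Circuit.eval_congr_lightCone`).
* **Fibre counting** (`two_pow_le_circuitCount_of_solvesPromise`): if a `B₂`-circuit `E` on
  `2ⁿ` inputs solves `MCSP[a, b]` at length `2ⁿ` (`Circuit.SolvesPromise`) and a YES instance
  exists,
  then all `≥ 2^{2ⁿ - size E - 1}` inputs agreeing with it on the light cone are accepted, so none
  is a NO instance, so each tabulates one of the `≤ (b+1)(16(n+b+1)²)ᵇ(n+b+1)` (`b = b n`)
  functions of complexity `≤ b n` (`card_filter_circuitSizeOver_le` of `MCSPStatisticalTest`, i.e.
  `CircuitCount.card_computable_le'`, Arora–Barak Thm. 6.21):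
  `2^{2ⁿ - size E - 1} ≤ (b+1)(16(n+b+1)²)ᵇ(n+b+1)`.
* **Family form** (`gapMCSP_not_mem_promiseLift_SIZEae`): if `(b+1)(16(n+b+1)²)ᵇ(n+b+1) <
  2^{2ⁿ - s(2ⁿ) - 1}` (`b = b n`) for infinitely many `n`, then
  `gapMCSP a b ∉ promiseLift (SIZEae s)` for
  EVERY `a` (the projection `v ↦ v₀` has complexity `0`, so YES is inhabited at every length
  `2ⁿ, n ≥ 1`); decision version `MCSPSize_not_mem_SIZEae` (`MCSP[θ]` separates `MCSP[θ, θ]`).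
* **Numerics of the sparse regime** (`eventually_circuitCount_noBound_lt`,
  `circuitCount_le_two_pow`): for `0 ≤ β < β' < 1`, eventually
  `(b+1)(16(n+b+1)²)ᵇ(n+b+1) ≤ 2^{(2n+8)(b+1)} < 2^{⌈(2ⁿ)^{β'}⌉ - 1}` for `b = ⌈2^{βn}⌉`. Hence,
  with
  `noBound β n = ⌈2^{βn}⌉` the NO threshold of OPS Thm. 1.4:
  `gapMCSP a b ∉ promiseLift (SIZEae (N ↦ N - ⌈N^{β'}⌉))` whenever eventually `b n ≤ ⌈2^{βn}⌉`
  (`gapMCSP_not_mem_SIZEae_sublinear`), `MCSP[θ] ∉ SIZEae / SIZE (N - ⌈N^{β'}⌉)` whenever eventually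
  `θ n ≤ ⌈2^{βn}⌉` (`MCSPSize_not_mem_SIZEae_sublinear`, `MCSPSize_not_mem_SIZE_sublinear`; every
  `θ = 2^{o(n)}` qualifies for every `β > 0`).
* **In the vocabulary of OPS Thm. 1.4** (`gapMCSPLowerBound_of_neg`): for every `c`, every
  `ε < 0` and every `0 ≤ β < 1`, `GapMCSPLowerBound c ε β` HOLDS (`⌊N^{1+ε}⌋ ≤ N - ⌈N^{β'}⌉`
  eventually). Theorem 1.4 needs it for SOME `ε > 0`: the distance between the kernel-checked known
  bound and the magnification threshold is exactly the sign of `ε` — the whole super-linear regime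
  (census row R3; rows R4/R32 of the census, `N · poly(s)` gates, likewise face `N - o(N)`).

Rendering notes. (i) The bound is stated for the tree's `SIZEae` (size bound at all sufficiently
large lengths; `SIZE ⊆ SIZEae`, `SIZE_subset_SIZEae`), the class of the typed hypotheses, and as
NON-MEMBERSHIP of the promise problem in `promiseLift` — failure at infinitely many lengths, which
is
all a family bound can say; the pointwise statement at each length `2ⁿ` is
`two_pow_le_circuitCount_of_solvesPromise` (at lengths that are not powers of two `MCSP[a, b]`
has no instances, so `PromiseProblem.EventuallyUnsolvable` is not the right predicate here).
(ii) No threshold is minted: `N - ⌈N^{β'}⌉` for every `β' ∈ (β, 1)` is what the counting argument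
gives (the count of easy functions is `2^{O(n·2^{βn})} = 2^{Õ(N^β)}`); the constant in front of `N`
is `1` because a fan-in-2 gate merges at most two light cones. (iii) Nothing here is specific to
`MCSP`: the argument is the generic "a circuit that ignores `k` inputs accepts `2^k` inputs along
with any one it accepts" count, which is why print calls the bound folklore; it is recorded as a
THEOREM, not as a cited fact.

References: [cite: OliveiraPichSanthanam2021, Thm. 1.4 (p. 6) and §1.1 Notation (p. 4: Circuit[s])];
[cite: ChenJinWilliams2020, p. 4 (Ω(n) folklore bound for MCSP; 6n barrier)];
[cite: MckayMurrayWilliams2019, Thm. 1.4]; [cite: AroraBarak2009, Thm. 6.21 (counting circuits)];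
[cite: BravyiGossetKonigScience2018, §2 Eq. (5) (light cones)]; [cite: Jukna2012, §1.2 (B₂, size)].
-/

namespace Literature.Computability.Complexity

open Finset

variable {ι : Type*}

namespace GateList

/-- Membership in `depOf`: a variable is read by the new gate iff it enters through an input wire
or lies in the dependency set of a gate wire. [folklore] -/
theorem mem_depOf_iff [DecidableEq ι] (ds : List (Finset ι)) (g : Gate ι) (x : ι) :
    x ∈ depOf ds g ↔
      ∃ a : Fin g.arity, (g.args a = .inl x) ∨ ∃ m : ℕ, g.args a = .inr m ∧ x ∈ ds.getD m ∅ := by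
  unfold depOf
  simp only [mem_biUnion, mem_univ, true_and]
  refine exists_congr fun a => ?_
  cases g.args a with
  | inl i => simp [eq_comm]
  | inr m => simp

/-- **Light cones of fan-in-`K` programs grow by at most `K - 1` per gate.** For every set `S` of
gate indices of a program `gs` all of whose gates have fan-in `≤ K`, the union of the
dependency sets of the gates in `S` has at most `(K - 1) · |gs| + |S|` elements (truncated
subtraction: for `K = 0` the bound is `|S|`). (Induction on the
program: the last gate contributes its `≤ K` wires, of which the gate wires are charged to `S`.)
[folklore] -/
theorem card_biUnion_deps_le [DecidableEq ι] {K : ℕ} (gs : List (Gate ι))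
    (hgs : ∀ g ∈ gs, g.arity ≤ K) (S : Finset ℕ) (hS : ∀ m ∈ S, m < gs.length) :
    (S.biUnion fun m => (deps gs).getD m ∅).card ≤ (K - 1) * gs.length + S.card := by
  induction gs using List.reverseRecOn generalizing S with
  | nil =>
    have hS0 : S = ∅ := eq_empty_of_forall_notMem fun m hm => absurd (hS m hm) (Nat.not_lt_zero m)
    subst hS0
    simp
  | append_singleton gs g ih =>
    have hgs' : ∀ g' ∈ gs, g'.arity ≤ K := fun g' hg' => hgs g' (by simp [hg'])
    have hg : g.arity ≤ K := hgs g (by simp)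
    have hlen : (gs ++ [g]).length = gs.length + 1 := by simp
    rw [hlen] at hS ⊢
    -- dependency sets of the shorter program, and how the longer one reads them
    have hF' : ∀ m, m < gs.length → (deps (gs ++ [g])).getD m ∅ = (deps gs).getD m ∅ := by
      intro m hm
      rw [deps_append_singleton, List.getD_append _ _ _ _ (by simpa using hm)]
    have hFL : (deps (gs ++ [g])).getD gs.length ∅ = depOf (deps gs) g := by
      rw [deps_append_singleton, List.getD_append_right _ _ _ _ (by simp)]
      simp
    by_cases hLS : gs.length ∈ S
    · -- the input wires and the in-range gate wires of `g`
      set I : Finset ι := univ.biUnion fun a =>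
          Sum.elim (fun i => ({i} : Finset ι)) (fun _ => ∅) (g.args a) with hI
      set G : Finset ℕ := univ.biUnion fun a =>
          Sum.elim (fun _ => (∅ : Finset ℕ)) (fun m => if m < gs.length then {m} else ∅)
            (g.args a) with hG
      -- `|I| + |G| ≤ fan-in ≤ K`
      have hIG : I.card + G.card ≤ K := by
        calc I.card + G.card
            ≤ (∑ a, (Sum.elim (fun i => ({i} : Finset ι)) (fun _ => ∅) (g.args a)).card) +
              ∑ a, (Sum.elim (fun _ => (∅ : Finset ℕ))
                (fun m => if m < gs.length then {m} else ∅) (g.args a)).card :=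
              Nat.add_le_add card_biUnion_le card_biUnion_le
          _ = ∑ a, ((Sum.elim (fun i => ({i} : Finset ι)) (fun _ => ∅) (g.args a)).card +
              (Sum.elim (fun _ => (∅ : Finset ℕ))
                (fun m => if m < gs.length then {m} else ∅) (g.args a)).card) :=
              sum_add_distrib.symm
          _ ≤ ∑ _a : Fin g.arity, 1 := sum_le_sum fun a _ => by
              cases g.args a with
              | inl i => simp
              | inr m => by_cases h : m < gs.length <;> simp [h]
          _ = g.arity := by simp
          _ ≤ K := hg
      -- the new index set, inside the shorter program
      set S' : Finset ℕ := S.erase gs.length ∪ G with hS'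
      have hS'lt : ∀ m ∈ S', m < gs.length := by
        intro m hm
        rcases mem_union.1 hm with hm | hm
        · have h1 := hS m (mem_of_mem_erase hm)
          have h2 := ne_of_mem_erase hm
          omega
        · simp only [hG, mem_biUnion, mem_univ, true_and] at hm
          obtain ⟨a, ha⟩ := hm
          cases hw : g.args a with
          | inl i => rw [hw] at ha; simp at ha
          | inr m' =>
            rw [hw] at ha
            by_cases h : m' < gs.length
            · simp [h] at ha; omega
            · simp [h] at ha
      have hcardS' : S'.card ≤ (S.card - 1) + G.card := by
        calc S'.card ≤ (S.erase gs.length).card + G.card := card_union_le _ _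
          _ = (S.card - 1) + G.card := by rw [card_erase_of_mem hLS]
      -- every variable read by a gate of `S` is an input wire of `g` or read by a gate of `S'`
      have hsub : (S.biUnion fun m => (deps (gs ++ [g])).getD m ∅) ⊆
          I ∪ S'.biUnion fun m => (deps gs).getD m ∅ := by
        intro x hx
        simp only [mem_biUnion] at hx
        obtain ⟨m, hmS, hx⟩ := hx
        have hmle : m < gs.length + 1 := hS m hmS
        rcases Nat.lt_or_ge m gs.length with hmL | hmL
        · rw [hF' m hmL] at hx
          exact mem_union_right _ (mem_biUnion.2
            ⟨m, mem_union_left _ (mem_erase.2 ⟨hmL.ne, hmS⟩), hx⟩)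
        · have hm : m = gs.length := by omega
          rw [hm, hFL, mem_depOf_iff] at hx
          obtain ⟨a, ha | ⟨m', hm', hx'⟩⟩ := hx
          · refine mem_union_left _ ?_
            simp only [hI, mem_biUnion, mem_univ, true_and]
            exact ⟨a, by rw [ha]; simp⟩
          · by_cases h : m' < gs.length
            · refine mem_union_right _ (mem_biUnion.2 ⟨m', mem_union_right _ ?_, hx'⟩)
              simp only [hG, mem_biUnion, mem_univ, true_and]
              exact ⟨a, by rw [hm']; simp [h]⟩
            · rw [List.getD_eq_default _ _ (by simp; omega)] at hx'
              simp at hx'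
      have hih := ih hgs' S' hS'lt
      have h1 : 1 ≤ S.card := card_pos.2 ⟨_, hLS⟩
      calc (S.biUnion fun m => (deps (gs ++ [g])).getD m ∅).card
          ≤ (I ∪ S'.biUnion fun m => (deps gs).getD m ∅).card := card_le_card hsub
        _ ≤ I.card + (S'.biUnion fun m => (deps gs).getD m ∅).card := card_union_le _ _
        _ ≤ I.card + ((K - 1) * gs.length + S'.card) := Nat.add_le_add_left hih _
        _ ≤ (K - 1) * (gs.length + 1) + S.card := by
            rw [Nat.mul_succ]
            omega
    · -- the last gate is not in `S`: everything happens inside the shorter program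
      have hSlt : ∀ m ∈ S, m < gs.length := fun m hm => by
        have h1 := hS m hm
        have h2 : m ≠ gs.length := fun h => hLS (h ▸ hm)
        omega
      have heq : (S.biUnion fun m => (deps (gs ++ [g])).getD m ∅) =
          S.biUnion fun m => (deps gs).getD m ∅ :=
        biUnion_congr rfl fun m hm => hF' m (hSlt m hm)
      rw [heq]
      calc (S.biUnion fun m => (deps gs).getD m ∅).card ≤ (K - 1) * gs.length + S.card :=
            ih hgs' S hSlt
        _ ≤ (K - 1) * (gs.length + 1) + S.card := by
            rw [Nat.mul_succ]; omega

/-- **Each dependency set of a fan-in-`K` program with `L` gates has at most `(K-1)·L + 1`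
elements.** [folklore] -/
theorem card_getD_deps_le_length [DecidableEq ι] {K : ℕ} (gs : List (Gate ι))
    (hgs : ∀ g ∈ gs, g.arity ≤ K) (m : ℕ) :
    ((deps gs).getD m ∅).card ≤ (K - 1) * gs.length + 1 := by
  rcases Nat.lt_or_ge m gs.length with hm | hm
  · simpa using card_biUnion_deps_le gs hgs {m} (by simpa using hm)
  · rw [List.getD_eq_default _ _ (by simpa using hm)]
    simp

end GateList

namespace Circuit

/-- **The light cone of a fan-in-`K` circuit with `s` gates has at most `(K-1)·s + 1` input
variables**: each gate merges at most `K` cones into one. [folklore] -/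
theorem card_lightCone_le_size [DecidableEq ι] (C : Circuit ι) {K : ℕ}
    (hC : ∀ g ∈ C.gates, g.arity ≤ K) : C.lightCone.card ≤ (K - 1) * C.size + 1 := by
  unfold lightCone size
  cases C.output with
  | inl i => simp
  | inr m => exact GateList.card_getD_deps_le_length C.gates hC m

/-- Over the basis `B₂` (fan-in `≤ 2`): **a circuit with `s` gates reads at most `s + 1` of its
input variables.** [folklore] -/
theorem card_lightCone_le_size_succ [DecidableEq ι] (C : Circuit ι) (hC : C.IsOver B2) :
    C.lightCone.card ≤ C.size + 1 := by
  simpa using C.card_lightCone_le_size (K := 2) fun g hg => hC g hg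

/-- **A circuit is constant on the fibres of its light cone**: at least `2 ^ (|ι| - |lightCone C|)`
inputs give the same output as any fixed input `z` (all inputs agreeing with `z` on the light
cone). [folklore] -/
theorem two_pow_le_card_filter_eval_eq [Fintype ι] [DecidableEq ι] (C : Circuit ι) (z : ι → Bool) :
    2 ^ (Fintype.card ι - C.lightCone.card) ≤ #{x : ι → Bool | C.eval x = C.eval z} := by
  classical
  set K := C.lightCone with hK
  -- extend an assignment of the variables outside the light cone by `z` inside it
  let ψ : (↥(Kᶜ) → Bool) → (ι → Bool) := fun u i =>
    if h : i ∈ K then z i else u ⟨i, mem_compl.2 h⟩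
  have hψinj : Function.Injective ψ := by
    intro u u' huu'
    funext j
    have hj : (j : ι) ∉ K := mem_compl.1 j.2
    have := congrFun huu' j
    simpa [ψ, hj] using this
  have hψmem : ∀ u, ψ u ∈ ({x : ι → Bool | C.eval x = C.eval z} : Finset (ι → Bool)) := by
    intro u
    simp only [mem_filter, mem_univ, true_and]
    exact C.eval_congr_lightCone fun i hi => by simp [ψ, hK ▸ hi]
  calc 2 ^ (Fintype.card ι - K.card)
      = Fintype.card (↥(Kᶜ) → Bool) := by
        rw [Fintype.card_fun, Fintype.card_bool, Fintype.card_coe, card_compl]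
    _ = (univ.image ψ).card := by rw [card_image_of_injective _ hψinj, card_univ]
    _ ≤ #{x : ι → Bool | C.eval x = C.eval z} :=
        card_le_card fun x hx => by
          obtain ⟨u, -, rfl⟩ := mem_image.1 hx
          exact hψmem u

end Circuit

end Literature.Computability.Complexity

namespace Literature.Computability.MetaComplexity

open Filter Finset Literature.Computability.Complexity

/-! ### The circuit-counting bound -/

/-- The tree's bound `(s+1)·(16(n+s+1)²)ˢ·(n+s+1)` on the number of `n`-variable Boolean functions
of `B₂`-circuit complexity `≤ s` (`CircuitCount.card_computable_le'`; Arora–Barak 2009, Thm. 6.21,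
proof) is monotone in the size threshold `s`. [folklore] -/
theorem circuitCount_mono (n : ℕ) {s s' : ℕ} (h : s ≤ s') :
    (s + 1) * (16 * (n + s + 1) ^ 2) ^ s * (n + s + 1) ≤
      (s' + 1) * (16 * (n + s' + 1) ^ 2) ^ s' * (n + s' + 1) := by
  have h1 : (16 * (n + s + 1) ^ 2) ^ s ≤ (16 * (n + s' + 1) ^ 2) ^ s' :=
    calc (16 * (n + s + 1) ^ 2) ^ s ≤ (16 * (n + s' + 1) ^ 2) ^ s :=
          Nat.pow_le_pow_left (Nat.mul_le_mul_left _ (Nat.pow_le_pow_left (by omega) 2)) s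
      _ ≤ (16 * (n + s' + 1) ^ 2) ^ s' := Nat.pow_le_pow_right (by positivity) h
  exact Nat.mul_le_mul (Nat.mul_le_mul (by omega) h1) (by omega)

/-! ### Fibre counting: a small circuit cannot solve `MCSP[a, b]` at a length `2ⁿ` -/

/-- **Fibre counting.** If a `B₂`-circuit `E` on `2ⁿ` inputs solves `MCSP[a, b]` at length `2ⁿ`
and some `n`-variable function `f₀` has complexity `≤ a n` (a YES instance exists), then
`2 ^ (2ⁿ - size E - 1) ≤ (b+1)(16(n+b+1)²)ᵇ(n+b+1)` (`b = b n`, the tree's circuit count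
`CircuitCount.card_computable_le'`): the `≥ 2^{2ⁿ - |lightCone E|}` inputs agreeing
with `tt f₀` on the light cone of `E` are all accepted (`Circuit.eval_congr_lightCone`), hence none
is a NO instance, so each tabulates a function of complexity `≤ b n`; and
`|lightCone E| ≤ size E + 1` (`Circuit.card_lightCone_le_size_succ`). [folklore] -/
theorem two_pow_le_circuitCount_of_solvesPromise {a b : ℕ → ℕ} {n : ℕ}
    (E : Circuit (Fin (2 ^ n))) (hE : E.IsOver B2) (hsol : E.SolvesPromise (gapMCSP a b))
    {f₀ : (Fin n → Bool) → Bool} (hf₀ : circuitSizeOver B2 f₀ ≤ a n) :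
    2 ^ (2 ^ n - E.size - 1) ≤ (b n + 1) * (16 * (n + b n + 1) ^ 2) ^ b n * (n + b n + 1) := by
  classical
  -- the function tabulated by an input of length `2ⁿ` (so that `tt (tbl x) = x`)
  let tbl : (Fin (2 ^ n) → Bool) → ((Fin n → Bool) → Bool) := fun x v => x (boolFunEquivFin n v)
  have htbl_inj : Function.Injective tbl := by
    intro x x' h
    funext i
    have := congrFun h ((boolFunEquivFin n).symm i)
    simpa [tbl] using this
  have htbl_tt : ∀ x, truthTable (tbl x) = List.ofFn x := by
    intro x
    simp [truthTable, tbl]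
  -- the YES instance `tt f₀` as an input `z`, accepted by `E`
  set z : Fin (2 ^ n) → Bool := fun i => f₀ ((boolFunEquivFin n).symm i) with hz
  have hz_yes : List.ofFn z ∈ (gapMCSP a b).yes := by
    rw [show List.ofFn z = truthTable f₀ from rfl, gapMCSP_yes, truthTable_mem_MCSPSize_iff]
    exact hf₀
  have hEz : E.eval z = true := (hsol z).1 hz_yes
  -- every input with the same output as `z` tabulates a function of complexity `≤ b n`
  have hsmall : ∀ x : Fin (2 ^ n) → Bool, E.eval x = E.eval z →
      circuitSizeOver B2 (tbl x) ≤ b n := by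
    intro x hx
    by_contra hlt
    have hno : List.ofFn x ∈ (gapMCSP a b).no := by
      rw [← htbl_tt, truthTable_mem_gapMCSP_no_iff]
      exact not_le.1 hlt
    have hrej := (hsol x).2 hno
    rw [hx, hEz] at hrej
    exact Bool.noConfusion hrej
  calc 2 ^ (2 ^ n - E.size - 1)
      ≤ 2 ^ (Fintype.card (Fin (2 ^ n)) - E.lightCone.card) := by
        refine Nat.pow_le_pow_right (by norm_num) ?_
        have := E.card_lightCone_le_size_succ hE
        simp only [Fintype.card_fin]
        omega
    _ ≤ #{x : Fin (2 ^ n) → Bool | E.eval x = E.eval z} := E.two_pow_le_card_filter_eval_eq z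
    _ ≤ #{f : (Fin n → Bool) → Bool | circuitSizeOver B2 f ≤ b n} := by
        refine card_le_card_of_injOn tbl (fun x hx => ?_) htbl_inj.injOn
        simp only [coe_filter, Set.mem_setOf_eq, mem_univ, true_and] at hx ⊢
        exact hsmall x hx
    _ ≤ (b n + 1) * (16 * (n + b n + 1) ^ 2) ^ b n * (n + b n + 1) :=
        card_filter_circuitSizeOver_le n (b n)

/-! ### The family lower bound -/

/-- **The folklore unconditional lower bound for `MCSP[a, b]` against general circuits (family
form).** If for infinitely many `n` fewer than `2 ^ (2ⁿ - s(2ⁿ) - 1)` functions on `n ≥ 1`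
variables have complexity `≤ b n`, then no language decided by `B₂`-circuit families of eventually
at most `s N` gates separates `MCSP[a, b]`: at such a length `2ⁿ` the deciding circuit would solve
the promise problem, the projection `v ↦ v 0` (complexity `0 ≤ a n`) is a YES instance, and
`two_pow_le_circuitCount_of_solvesPromise` contradicts the count. [folklore] -/
theorem gapMCSP_not_mem_promiseLift_SIZEae {a b s : ℕ → ℕ}
    (h : ∃ᶠ n : ℕ in atTop,
      (b n + 1) * (16 * (n + b n + 1) ^ 2) ^ b n * (n + b n + 1) < 2 ^ (2 ^ n - s (2 ^ n) - 1)) :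
    gapMCSP a b ∉ promiseLift (SIZEae s) := by
  rintro ⟨L, ⟨C, ⟨n₀, hn₀⟩, hCL⟩, hy, hn⟩
  obtain ⟨n, hn₁, hlt⟩ := frequently_atTop.1 h (max n₀ 1)
  have hn0 : n₀ ≤ 2 ^ n := (le_max_left _ _).trans (hn₁.trans n.lt_two_pow_self.le)
  have hn1 : 1 ≤ n := (le_max_right _ _).trans hn₁
  have hsol := hCL.solvesPromise hy hn (2 ^ n)
  obtain ⟨hB, hsize⟩ := hn₀ (2 ^ n) hn0
  -- YES witness: the projection to the first variable has complexity `0`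
  have hf₀ : circuitSizeOver B2 (fun v : Fin n → Bool => v ⟨0, hn1⟩) ≤ a n :=
    (circuitSizeOver_le_of_computes (f := fun v : Fin n → Bool => v ⟨0, hn1⟩)
      (Circuit.input (⟨0, hn1⟩ : Fin n)) (fun g hg => by cases hg) (fun _ => rfl)).trans (by simp)
  have key := two_pow_le_circuitCount_of_solvesPromise (C (2 ^ n)) hB hsol hf₀
  have hmono : 2 ^ (2 ^ n - s (2 ^ n) - 1) ≤ 2 ^ (2 ^ n - (C (2 ^ n)).size - 1) :=
    Nat.pow_le_pow_right (by norm_num) (by omega)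
  exact absurd (hmono.trans key) (not_le.2 hlt)

/-- **Decision version.** Under the same count, `MCSP[θ] ∉ SIZEae s`: the language `MCSP[θ]`
itself separates `MCSP[θ, θ]`. [folklore] -/
theorem MCSPSize_not_mem_SIZEae {θ s : ℕ → ℕ}
    (h : ∃ᶠ n : ℕ in atTop,
      (θ n + 1) * (16 * (n + θ n + 1) ^ 2) ^ θ n * (n + θ n + 1) < 2 ^ (2 ^ n - s (2 ^ n) - 1)) :
    MCSPSize θ ∉ SIZEae s := by
  intro hmem
  refine gapMCSP_not_mem_promiseLift_SIZEae (a := θ) h ⟨MCSPSize θ, hmem, le_rfl, ?_⟩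
  rintro w ⟨n, f, rfl, hf⟩ hw
  exact absurd ((truthTable_mem_MCSPSize_iff θ f).1 hw) (not_le.2 hf)

/-! ### Numerics: the count against `2 ^ (2ⁿ - s(2ⁿ) - 1)` for `s(N) = N - ⌈N^{β'}⌉` -/

/-- Crude size of the counting bound: for `n ≥ 1` and `b ≤ 2ⁿ`,
`(b+1)(16(n+b+1)²)ᵇ(n+b+1) ≤ 2 ^ ((2n + 8)(b + 1))` (`n + b + 1 ≤ 2^{n+2}`). [folklore] -/
theorem circuitCount_le_two_pow {n b : ℕ} (hn : 1 ≤ n) (hb : b ≤ 2 ^ n) :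
    (b + 1) * (16 * (n + b + 1) ^ 2) ^ b * (n + b + 1) ≤ 2 ^ ((2 * n + 8) * (b + 1)) := by
  have hn2 : n + 1 ≤ 2 ^ n := by
    have := n.lt_two_pow_self
    omega
  have ht : n + b + 1 ≤ 2 ^ (n + 2) := by
    have : 2 ^ (n + 2) = 4 * 2 ^ n := by rw [pow_add]; ring
    omega
  have hb1 : b + 1 ≤ 2 ^ (n + 2) := le_trans (by omega) ht
  have h16 : 16 * (n + b + 1) ^ 2 ≤ 2 ^ (2 * n + 8) :=
    calc 16 * (n + b + 1) ^ 2 ≤ 16 * (2 ^ (n + 2)) ^ 2 :=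
          Nat.mul_le_mul_left _ (Nat.pow_le_pow_left ht 2)
      _ = 2 ^ (2 * n + 8) := by
          rw [← pow_mul, show (16 : ℕ) = 2 ^ 4 by norm_num, ← pow_add]
          congr 1; ring
  calc (b + 1) * (16 * (n + b + 1) ^ 2) ^ b * (n + b + 1)
      ≤ 2 ^ (n + 2) * (2 ^ (2 * n + 8)) ^ b * 2 ^ (n + 2) :=
        Nat.mul_le_mul (Nat.mul_le_mul hb1 (Nat.pow_le_pow_left h16 b)) ht
    _ = 2 ^ ((n + 2) + (2 * n + 8) * b + (n + 2)) := by
        rw [← pow_mul, ← pow_add, ← pow_add]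
    _ ≤ 2 ^ ((2 * n + 8) * (b + 1)) := Nat.pow_le_pow_right (by norm_num) (by nlinarith)

/-- **The numerics of the sparse regime.** For `0 ≤ β < β' < 1`: eventually (in `n`)
the circuit count at `b = ⌈2^{βn}⌉` is `< 2 ^ (2ⁿ - (2ⁿ - ⌈(2ⁿ)^{β'}⌉) - 1)`, i.e. the count of
functions of
complexity `≤ 2^{βn}` is below the number `2^{⌈(2ⁿ)^{β'}⌉ - 1}` of inputs a circuit with
`2ⁿ - ⌈(2ⁿ)^{β'}⌉` gates cannot distinguish (`(2n+8)(2^{βn}+2) + 2 ≤ 32n·2^{βn} ≤ 2^{β'n}` for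
large `n`, as `n/2^{(β'-β)n} → 0`). [folklore] -/
theorem eventually_circuitCount_noBound_lt {β β' : ℝ} (hβ : 0 ≤ β) (hββ' : β < β')
    (hβ'1 : β' < 1) :
    ∀ᶠ n : ℕ in atTop,
      (OliveiraPichSanthanam2019.noBound β n + 1) *
            (16 * (n + OliveiraPichSanthanam2019.noBound β n + 1) ^ 2) ^
              OliveiraPichSanthanam2019.noBound β n *
          (n + OliveiraPichSanthanam2019.noBound β n + 1) <
        2 ^ (2 ^ n - (2 ^ n - ⌈((2 ^ n : ℕ) : ℝ) ^ β'⌉₊) - 1) := by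
  -- `32 n ≤ r ^ n` eventually, `r = 2^{β'-β} > 1`
  set r : ℝ := (2 : ℝ) ^ (β' - β) with hrdef
  have hr1 : 1 < r := Real.one_lt_rpow (by norm_num) (by linarith)
  have hlim := tendsto_pow_const_div_const_pow_of_one_lt 1 hr1
  have hev : ∀ᶠ n : ℕ in atTop, (n : ℝ) ^ 1 / r ^ n < 1 / 32 :=
    hlim.eventually (gt_mem_nhds (by norm_num))
  filter_upwards [hev, eventually_ge_atTop 1] with n hn hn1
  have hrn : (0 : ℝ) < r ^ n := by positivity
  rw [pow_one, div_lt_iff₀ hrn] at hn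
  -- notation
  have h2n : (1 : ℝ) ≤ (2 : ℝ) ^ (n : ℕ) := one_le_pow₀ (by norm_num)
  have hcast : (((2 ^ n : ℕ) : ℝ)) = (2 : ℝ) ^ (n : ℕ) := by push_cast; ring
  set b : ℕ := OliveiraPichSanthanam2019.noBound β n with hbdef
  set T : ℕ := ⌈((2 ^ n : ℕ) : ℝ) ^ β'⌉₊ with hTdef
  -- real forms of the powers
  have hB : (2 : ℝ) ^ (β * n) * r ^ n = (2 : ℝ) ^ (β' * n) := by
    rw [hrdef, ← Real.rpow_natCast ((2 : ℝ) ^ (β' - β)) n, ← Real.rpow_mul (by norm_num),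
      ← Real.rpow_add (by norm_num)]
    congr 1; ring
  have hTpow : ((2 ^ n : ℕ) : ℝ) ^ β' = (2 : ℝ) ^ (β' * n) := by
    rw [hcast, ← Real.rpow_natCast (2 : ℝ) n, ← Real.rpow_mul (by norm_num)]
    congr 1; ring
  have hβn : (1 : ℝ) ≤ (2 : ℝ) ^ (β * n) := Real.one_le_rpow (by norm_num) (by positivity)
  -- `b < 2^{βn} + 1`, `b ≤ 2ⁿ`, `T ≤ 2ⁿ`, `2^{β' n} ≤ T`
  have hb_lt : (b : ℝ) < (2 : ℝ) ^ (β * n) + 1 := Nat.ceil_lt_add_one (by positivity)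
  have hb_le : b ≤ 2 ^ n := by
    rw [hbdef, OliveiraPichSanthanam2019.noBound, Nat.ceil_le]
    calc (2 : ℝ) ^ (β * n) ≤ (2 : ℝ) ^ ((n : ℕ) : ℝ) :=
          Real.rpow_le_rpow_of_exponent_le (by norm_num)
            (by nlinarith [show (0 : ℝ) ≤ n from Nat.cast_nonneg n])
      _ = ((2 ^ n : ℕ) : ℝ) := by rw [Real.rpow_natCast]; push_cast; ring
  have hT_le : T ≤ 2 ^ n := by
    rw [hTdef, Nat.ceil_le, hcast]
    calc ((2 : ℝ) ^ (n : ℕ)) ^ β' ≤ ((2 : ℝ) ^ (n : ℕ)) ^ (1 : ℝ) :=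
          Real.rpow_le_rpow_of_exponent_le h2n hβ'1.le
      _ = (2 : ℝ) ^ (n : ℕ) := by rw [Real.rpow_one]
  have hT_ge : (2 : ℝ) ^ (β' * n) ≤ T := by rw [hTdef, ← hTpow]; exact Nat.le_ceil _
  -- the exponent comparison, in `ℝ` then in `ℕ`
  have hkeyR : ((2 * n + 8) * (b + 1) + 2 : ℝ) ≤ (2 : ℝ) ^ (β' * n) := by
    have hn1' : (1 : ℝ) ≤ n := by exact_mod_cast hn1
    calc ((2 * n + 8) * (b + 1) + 2 : ℝ)
        ≤ (2 * n + 8) * ((2 : ℝ) ^ (β * n) + 2) + 2 := by nlinarith [hb_lt.le]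
      _ ≤ (2 * n + 8) * (3 * (2 : ℝ) ^ (β * n)) + 2 * (2 : ℝ) ^ (β * n) := by nlinarith
      _ = (6 * n + 26) * (2 : ℝ) ^ (β * n) := by ring
      _ ≤ (32 * n) * (2 : ℝ) ^ (β * n) := by nlinarith
      _ ≤ r ^ n * (2 : ℝ) ^ (β * n) := by nlinarith [hn.le]
      _ = (2 : ℝ) ^ (β' * n) := by rw [mul_comm, hB]
  have hkey : (2 * n + 8) * (b + 1) + 2 ≤ T := by exact_mod_cast hkeyR.trans hT_ge
  -- assemble
  calc (b + 1) * (16 * (n + b + 1) ^ 2) ^ b * (n + b + 1)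
      ≤ 2 ^ ((2 * n + 8) * (b + 1)) := circuitCount_le_two_pow hn1 hb_le
    _ < 2 ^ (2 ^ n - (2 ^ n - T) - 1) := Nat.pow_lt_pow_right (by norm_num) (by omega)

/-- **Gap-MCSP with NO threshold `≤ ⌈2^{βn}⌉` is not separated by circuits with `N - ⌈N^{β'}⌉`
gates**, for any `0 ≤ β < β' < 1` and ANY YES threshold `a` (the folklore `N - o(N)` lower bound,
kernel-checked; in particular for the parameters `MCSP[2^{βn}/cn, 2^{βn}]` of
Oliveira–Pich–Santhanam, Thm. 1.4, whose magnification threshold is `N^{1+ε}` gates).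
[folklore] -/
theorem gapMCSP_not_mem_SIZEae_sublinear {a b : ℕ → ℕ} {β β' : ℝ} (hβ : 0 ≤ β) (hββ' : β < β')
    (hβ'1 : β' < 1) (hb : ∀ᶠ n : ℕ in atTop, b n ≤ OliveiraPichSanthanam2019.noBound β n) :
    gapMCSP a b ∉ promiseLift (SIZEae fun N => N - ⌈(N : ℝ) ^ β'⌉₊) := by
  refine gapMCSP_not_mem_promiseLift_SIZEae (Eventually.frequently ?_)
  filter_upwards [eventually_circuitCount_noBound_lt hβ hββ' hβ'1, hb] with n hn hbn
  exact (circuitCount_mono n hbn).trans_lt hn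

/-- **`MCSP[θ] ∉ SIZEae[N - ⌈N^{β'}⌉]`** whenever eventually `θ n ≤ ⌈2^{βn}⌉`, `0 ≤ β < β' < 1`
(decision version; e.g. every `θ` with `log θ(n) = o(n)` qualifies for every `β > 0`). [folklore] -/
theorem MCSPSize_not_mem_SIZEae_sublinear {θ : ℕ → ℕ} {β β' : ℝ} (hβ : 0 ≤ β) (hββ' : β < β')
    (hβ'1 : β' < 1) (hθ : ∀ᶠ n : ℕ in atTop, θ n ≤ OliveiraPichSanthanam2019.noBound β n) :
    MCSPSize θ ∉ SIZEae fun N => N - ⌈(N : ℝ) ^ β'⌉₊ := by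
  refine MCSPSize_not_mem_SIZEae (Eventually.frequently ?_)
  filter_upwards [eventually_circuitCount_noBound_lt hβ hββ' hβ'1, hθ] with n hn hθn
  exact (circuitCount_mono n hθn).trans_lt hn

/-- The every-length version: `MCSP[θ] ∉ SIZE[N - ⌈N^{β'}⌉]` (`SIZE s ⊆ SIZEae s`) — the known
side facing McKay–Murray–Williams, Thm. 1.4 (`MckayMurrayWilliams2019_thm14`: needed
`MCSP[s] ∉ SIZE[N · poly(s(log N))]`). [folklore] -/
theorem MCSPSize_not_mem_SIZE_sublinear {θ : ℕ → ℕ} {β β' : ℝ} (hβ : 0 ≤ β) (hββ' : β < β')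
    (hβ'1 : β' < 1) (hθ : ∀ᶠ n : ℕ in atTop, θ n ≤ OliveiraPichSanthanam2019.noBound β n) :
    MCSPSize θ ∉ SIZE fun N => N - ⌈(N : ℝ) ^ β'⌉₊ :=
  fun h => MCSPSize_not_mem_SIZEae_sublinear hβ hββ' hβ'1 hθ (SIZE_subset_SIZEae _ h)

/-! ### In the vocabulary of Oliveira–Pich–Santhanam, Theorem 1.4 -/

/-- **The known exponent for row R3 is every `1 + ε < 1`.** For `ε < 0` and `0 ≤ β < 1`,
`GapMCSPLowerBound c ε β` HOLDS (unconditionally, for every `c`): `⌊N^{1+ε}⌋ ≤ N - ⌈N^{β'}⌉`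
eventually for `β' = (max β (1+ε) + 1)/2 < 1`, so `SIZEae (sizeBound ε) ⊆ SIZEae (N - ⌈N^{β'}⌉)`.
Theorem 1.4 needs `GapMCSPLowerBound c ε β` for SOME `ε > 0` (and all small `β`): the gap between
the known and the needed is exactly the sign of `ε`, i.e. the super-linear regime. [folklore] -/
theorem gapMCSPLowerBound_of_neg (c : ℕ) {ε β : ℝ} (hε : ε < 0) (hβ : 0 ≤ β) (hβ1 : β < 1) :
    OliveiraPichSanthanam2019.GapMCSPLowerBound c ε β := by
  -- an exponent strictly between `max β (1+ε)` and `1`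
  set γ : ℝ := max β (1 + ε) with hγdef
  have hγ1 : γ < 1 := max_lt hβ1 (by linarith)
  set β' : ℝ := (γ + 1) / 2 with hβ'def
  have hβ'1 : β' < 1 := by rw [hβ'def]; linarith
  have hγβ' : γ < β' := by rw [hβ'def]; linarith
  have hββ' : β < β' := (le_max_left _ _).trans_lt hγβ'
  have hεβ' : 1 + ε < β' := (le_max_right _ _).trans_lt hγβ'
  have h0β' : 0 < β' := hβ.trans_lt hββ'
  -- eventually `⌊N^{1+ε}⌋ ≤ N - ⌈N^{β'}⌉`
  have hmono : ∃ n₁ : ℕ, ∀ N ≥ n₁,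
      OliveiraPichSanthanam2019.sizeBound ε N ≤ N - ⌈(N : ℝ) ^ β'⌉₊ := by
    have htend : Tendsto (fun N : ℕ => (N : ℝ) ^ (1 - β')) atTop atTop :=
      (tendsto_rpow_atTop (by linarith)).comp tendsto_natCast_atTop_atTop
    obtain ⟨n₁, hn₁⟩ := eventually_atTop.1
      ((htend.eventually_ge_atTop 3).and (eventually_ge_atTop 1))
    refine ⟨n₁, fun N hN => ?_⟩
    obtain ⟨h3, hN1⟩ := hn₁ N hN
    have hN1' : (1 : ℝ) ≤ N := by exact_mod_cast hN1
    have hNpos : (0 : ℝ) < N := by linarith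
    have hsplit : (N : ℝ) ^ β' * (N : ℝ) ^ (1 - β') = N := by
      rw [← Real.rpow_add hNpos]; norm_num
    have hpow_le : (N : ℝ) ^ (1 + ε) ≤ (N : ℝ) ^ β' :=
      Real.rpow_le_rpow_of_exponent_le hN1' hεβ'.le
    have hone : (1 : ℝ) ≤ (N : ℝ) ^ β' := Real.one_le_rpow hN1' h0β'.le
    have hceil_lt : (⌈(N : ℝ) ^ β'⌉₊ : ℝ) < (N : ℝ) ^ β' + 1 := Nat.ceil_lt_add_one (by positivity)
    have hceil_le : ⌈(N : ℝ) ^ β'⌉₊ ≤ N := by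
      rw [Nat.ceil_le]
      calc (N : ℝ) ^ β' ≤ (N : ℝ) ^ (1 : ℝ) := Real.rpow_le_rpow_of_exponent_le hN1' hβ'1.le
        _ = N := Real.rpow_one _
    -- in `ℝ`: `N^{1+ε} ≤ N - ⌈N^{β'}⌉`
    have hR : (N : ℝ) ^ (1 + ε) ≤ (N : ℝ) - ⌈(N : ℝ) ^ β'⌉₊ := by
      have : 3 * (N : ℝ) ^ β' ≤ N := by
        calc 3 * (N : ℝ) ^ β' ≤ (N : ℝ) ^ (1 - β') * (N : ℝ) ^ β' :=
              mul_le_mul_of_nonneg_right h3 (by positivity)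
          _ = N := by rw [mul_comm, hsplit]
      linarith
    have hR' : ((OliveiraPichSanthanam2019.sizeBound ε N : ℕ) : ℝ) ≤
        ((N - ⌈(N : ℝ) ^ β'⌉₊ : ℕ) : ℝ) := by
      rw [Nat.cast_sub hceil_le]
      exact (Nat.floor_le (by positivity)).trans hR
    exact_mod_cast hR'
  intro hmem
  exact gapMCSP_not_mem_SIZEae_sublinear (a := OliveiraPichSanthanam2019.yesBound c β) hβ hββ'
    hβ'1 (Eventually.of_forall fun n => le_rfl) (promiseLift_mono (SIZEae_mono hmono) hmem)

end Literature.Computability.MetaComplexity
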